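import Summits.BirchSwinnertonDyer.BirchSwinnertonDyer.Theorems.KimAtThreeAnomalousTorsion
import Summits.BirchSwinnertonDyer.BirchSwinnertonDyer.Theorems.KimAtThreeFineKatoKPortJunctionFrobenius
import HarnessLib

/-!
# K-PORT junction (J7): the ANOMALOUS lattice lemma `log_ω E(L_w) = E_p(φ)⁻¹𝒪_w` with the
# fixed-field and order binders discharged — only ROW hypotheses remain
# (cell `bsd-addord`, seat w2-kport gen 8; `--supports stmt-BirchSwinnertonDyer-19560`, helper)

HONEST FRAMING. Route W2 (`route-BirchSwinnertonDyer-KimAtThreeKolyvagin`), crux 19560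
`KatoKuriharaPortThreeShared`; the E-side LATTICE LEMMA on the good-ANOMALOUS `t = 0` rows (items
19679 / 19599, support item 20397 `FineKatoTauAnomalousThree`). w2-acc3 gen 7 landed
`KimAtThreeAnomalousTorsion` (2026-08-27): `E(L_w)[p] = 0` on an anomalous row and the lattice lemma
`exists_padicLog_eq_iff_of_frobenius_anomalous`, displaying THREE structural binders a consumer still had
to supply — `hord : ord σ = f(w∣p)`, `hfix` («elements of `L_w` fixed by `σ_w` come from a subfield `F`»)
and `hF : E(F)[p] = 0` for that `F`. All three are settled by the K-port: `hord` is gen 7's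
`Kw.orderOf_eq_inertiaDeg_of_frobenius`; with `F := ℚ_[p]` (the port's `ℚ_[p]`-structure of
`K_w = L_w`, `Kw.instAlgebraPadic`), `hfix` is gen 7's residue descent
`KPort.mem_range_algebraMap_of_apply_eq` (a Frobenius lift of an unramified `K` fixes exactly `ℚ_p`),
and `hF` becomes LITERALLY the row hypothesis `E(ℚ_p)[p] = 0` (`Nat.card {Q // p • Q = 0} = 1` in the
items' spelling). This file performs that discharge. TOOL theorems only (no definition, no instance,
no named fact, no `sorry`); closes nothing by itself; nothing booked; BSD / 19560 / 19679 are not proved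
by any of this.

## What is proved (`W/ℚ` globally minimal, `p ≥ 3`, `p ∤ Δ_min(W)`, `a_p ≡ 1 (mod p)`, `e(w∣p) = 1`)

* §1 `isScalarTower_rat_padic_completion` (the port's `ℚ_[p] → L_w` is `ℚ`-compatible),
  `mem_range_algebraMap_completion_of_apply_eq` (an element of `L_w` fixed by a Frobenius lift `φ` of
  `K_w` lies in `ℚ_[p]`), `forall_nsmul_eq_zero_of_natCard_eq_one` (the items' `Nat.card = 1` spelling
  of `E(ℚ_p)[p] = 0` gives the pointwise one).
* §2 **`forall_prime_nsmul_eq_zero_of_frobeniusLift_anomalous`** — `E(L_w)[p] = 0` from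
  `E(ℚ_p)[p] = 0` and ANY `φ : K_w →ₐ[ℚ_[p]] K_w` lifting `x ↦ x^p`; `…_of_frobenius_anomalous'` — the
  same from a global Frobenius `σ ∈ Aut(L/ℚ)` (`σ • w = w`, `σ a ≡ a^p (mod w)`), NO `hfix`.
* §3 **`exists_padicLog_eq_iff_norm_eulerOperator_le_of_frobeniusLift_anomalous`** —
  `(∃ P ∈ E(L_w), log_ω P = y) ↔ ‖φφy − a_p·φy + p·y‖ ≤ ‖p‖` with binders
  `(hp3) (hΔ) (hap) (hF : E(ℚ_p)[p] = 0) (φ) (hφp)` only; **`exists_padicLog_eq_iff_of_frobenius_anomalous'`**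
  — acc3's global-Frobenius form WITHOUT `hord` / `hfix` and with `hF` at `F = ℚ_[p]`;
  `…_of_natCard_eq_one` twins taking the items' `Nat.card {Q // p • Q = 0} = 1`.

References: J. H. Silverman, *AEC* (2009) VII.3.1, IV.6.1, V.2.3.1 [SilvermanAEC2009];
S. Bloch, K. Kato (1990) Example 3.11 [BlochKato1990]; J.-P. Serre, *Local Fields* (1979) Ch. I §8,
Ch. III §5 [SerreLocalFields1979].
-/

noncomputable section

-- the cell's Theorems namespace `Summit.BirchSwinnertonDyer.BirchSwinnertonDyer.…` repeats the summit name by design (D-0017)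
set_option linter.dupNamespace false

open scoped Classical NNReal NumberField Pointwise
open IsDedekindDomain NumberField
open Literature.NumberTheory.Automorphic Literature.NumberTheory.AdelicBaseChange
open Summit.BirchSwinnertonDyer.BirchSwinnertonDyer.Theorems.KimAtThreeEulerLatticeOfFrobenius
open Summit.BirchSwinnertonDyer.BirchSwinnertonDyer.Theorems.KimAtThreeKwFrobenius
open Summit.BirchSwinnertonDyer.BirchSwinnertonDyer.Theorems.KimAtThreeAnomalousTorsion

namespace Summit.BirchSwinnertonDyer.BirchSwinnertonDyer.Theorems.KPort.Kw

variable {p : ℕ} [hp : Fact p.Prime] {L : Type} [Field L] [NumberField L]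
  {w : ((Rat.HeightOneSpectrum.primesEquiv (R := 𝓞 ℚ)).symm ⟨p, hp.out⟩).Extension (𝓞 L)}

/-! ## §1 The port's `ℚ_[p] → L_w`, fixed elements of a Frobenius lift, and the `Nat.card` spelling -/

/-- The port's `ℚ_[p]`-algebra structure of `K_w` (`Kw.instAlgebraPadic`: `ℚ_[p] ≅ ℚ_v → L_w`), read on
`L_w = w.1.adicCompletion L`, is compatible with the `ℚ`-structures (ring maps out of `ℚ` are unique).
[folklore] -/
theorem isScalarTower_rat_padic_completion :
    letI : Algebra ℚ_[p] (w.1.adicCompletion L) := Kw.instAlgebraPadic p L w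
    IsScalarTower ℚ ℚ_[p] (w.1.adicCompletion L) := by
  letI : Algebra ℚ_[p] (w.1.adicCompletion L) := Kw.instAlgebraPadic p L w
  exact IsScalarTower.of_algebraMap_eq' (Subsingleton.elim _ _)

/-- **An element of `L_w` fixed by a Frobenius lift lies in `ℚ_p`.** For `w ∣ p` unramified
(`e(w∣p) = 1`) and `φ : K_w →ₐ[ℚ_[p]] K_w` lifting `x ↦ x^p` (`hφp`), read on `L_w` as `φK`: every
`φK`-fixed `z ∈ L_w` is in the image of `ℚ_[p]` (gen 7's residue descent
`KPort.mem_range_algebraMap_of_apply_eq` through the identity `K_w = L_w`).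
[cite: SerreLocalFields1979, Ch. I §7–§8 and Ch. III §5] -/
theorem mem_range_algebraMap_completion_of_apply_eq [he : Fact (w.1.asIdeal.ramificationIdx (𝓞 ℚ) = 1)]
    (φ : Kw p L w →ₐ[ℚ_[p]] Kw p L w) (hφp : ∀ x : Kw p L w, ‖x‖ ≤ 1 → ‖φ x - x ^ p‖ < 1)
    {φK : w.1.adicCompletion L → w.1.adicCompletion L}
    (hφK : ∀ x, φK x = toCompletion p L w (φ ((toCompletion p L w).symm x)))
    {z : w.1.adicCompletion L} (hz : φK z = z) :
    letI : Algebra ℚ_[p] (w.1.adicCompletion L) := Kw.instAlgebraPadic p L w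
    z ∈ Set.range (algebraMap ℚ_[p] (w.1.adicCompletion L)) := by
  haveI : IsUltrametricDist (Kw p L w) := isUltrametricDist (p := p) (L := L) (w := w)
  have hK : ∀ x : Kw p L w, ‖x‖ < 1 → ‖x‖ ≤ ‖((p : ℕ) : Kw p L w)‖ :=
    fun x hx => norm_le_norm_prime_of_norm_lt_one he.out x hx
  have hz' : φ ((toCompletion p L w).symm z) = (toCompletion p L w).symm z := by
    apply (toCompletion p L w).injective
    rw [← hφK, hz, RingEquiv.apply_symm_apply]
  obtain ⟨c, hc⟩ := mem_range_algebraMap_of_apply_eq hK hφp hz'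
  exact ⟨c, hc⟩

omit hp in
/-- The items' spelling `Nat.card {Q // p • Q = 0} = 1` of «`E(F)` has no `p`-torsion» gives the
pointwise form `p • Q = 0 → Q = 0`. [folklore] -/
theorem forall_nsmul_eq_zero_of_natCard_eq_one {F : Type*} [Field F] (V : WeierstrassCurve F)
    (ht : Nat.card {Q : V.toAffine.Point // (p : ℕ) • Q = 0} = 1)
    (Q : V.toAffine.Point) (hQ : p • Q = 0) : Q = 0 := by
  have hs := (Nat.card_eq_one_iff_unique.mp ht).1
  exact congrArg Subtype.val (hs.elim ⟨Q, hQ⟩ ⟨0, smul_zero _⟩)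

/-! ## §2 `E(L_w)[p] = 0` on an anomalous row from `E(ℚ_p)[p] = 0` and a Frobenius lift -/

variable (W : WeierstrassCurve ℚ) [W.IsElliptic] [W.IsGloballyMinimal]

/-- **No `p`-torsion in `E(L_w)` at an anomalous good prime, from `E(ℚ_p)[p] = 0` — fixed field
discharged.** `W/ℚ` globally minimal, `p ≥ 3`, `p ∤ Δ_min(W)`, `a_p ≡ 1 (mod p)`; `w ∣ p` with
`e(w∣p) = 1`; `φ : K_w →ₐ[ℚ_[p]] K_w` ANY lift of `x ↦ x^p` (`hφp`); `E(ℚ_p)[p] = 0`. Then `E(L_w)[p] = 0`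
(acc3's `forall_prime_nsmul_eq_zero_of_anomalous` at `F := ℚ_[p]`, its `hfix` discharged by §1, its
isometry / lift binders by the port). [cite: SilvermanAEC2009, VII.3 Prop. 3.1, IV.6 Thm. 6.1 and V.2.3.1] -/
theorem forall_prime_nsmul_eq_zero_of_frobeniusLift_anomalous
    [he : Fact (w.1.asIdeal.ramificationIdx (𝓞 ℚ) = 1)]
    (hp3 : 3 ≤ p) (hΔ : ¬ (p : ℤ) ∣ WeierstrassCurve.minimalDiscriminantInt W)
    (hap : (p : ℤ) ∣ W.frobeniusTrace p - 1)
    (hF : ∀ Q : (W.baseChange ℚ_[p]).toAffine.Point, p • Q = 0 → Q = 0)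
    (φ : Kw p L w →ₐ[ℚ_[p]] Kw p L w) (hφp : ∀ x : Kw p L w, ‖x‖ ≤ 1 → ‖φ x - x ^ p‖ < 1)
    (P : (W.baseChange (w.1.adicCompletion L)).toAffine.Point) (hP : p • P = 0) : P = 0 := by
  haveI : IsUltrametricDist (Kw p L w) := isUltrametricDist (p := p) (L := L) (w := w)
  letI : Algebra ℚ_[p] (w.1.adicCompletion L) := Kw.instAlgebraPadic p L w
  haveI : IsScalarTower ℚ ℚ_[p] (w.1.adicCompletion L) := isScalarTower_rat_padic_completion
  let φK : w.1.adicCompletion L →ₐ[ℚ] w.1.adicCompletion L :=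
    ((toCompletion p L w).toRingHom.comp
      ((φ : Kw p L w →+* Kw p L w).comp (toCompletion p L w).symm.toRingHom)).toRatAlgHom
  have hφK : ∀ x, φK x = toCompletion p L w (φ ((toCompletion p L w).symm x)) := fun _ => rfl
  exact forall_prime_nsmul_eq_zero_of_anomalous w.1 W (prime_mem_asIdeal w) hp3 hΔ
    (norm_le_norm_natCast_of_norm_lt_one p L w) φK
    (norm_conj_eq p L w φ (norm_algHom_eq φ) φK hφK)
    (norm_conj_sub_pow_lt p L w φ hφp φK hφK) hap
    (fun _ hz => mem_range_algebraMap_completion_of_apply_eq φ hφp hφK hz) hF P hP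

/-- **`E(L_w)[p] = 0` on a good-anomalous row from a GLOBAL Frobenius — no fixed-field binder.**
acc3's `forall_prime_nsmul_eq_zero_of_frobenius` with `hfix` DISCHARGED and `F := ℚ_[p]`: `W/ℚ` globally
minimal, `p ≥ 3`, `p ∤ Δ_min(W)`, `a_p ≡ 1 (mod p)`, `e(w∣p) = 1`, `σ ∈ Aut(L/ℚ)` with `σ • w = w` and
`σ • a ≡ a^p (mod 𝔭_w)` on `𝓞 L`, and `E(ℚ_p)[p] = 0`; then `E(L_w)` has no `p`-torsion.
[cite: SilvermanAEC2009, VII.3 Prop. 3.1, IV.6 Thm. 6.1 and V.2.3.1] -/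
theorem forall_prime_nsmul_eq_zero_of_frobenius_anomalous'
    [he : Fact (w.1.asIdeal.ramificationIdx (𝓞 ℚ) = 1)]
    (hp3 : 3 ≤ p) (hΔ : ¬ (p : ℤ) ∣ WeierstrassCurve.minimalDiscriminantInt W)
    (hap : (p : ℤ) ∣ W.frobeniusTrace p - 1)
    (hF : ∀ Q : (W.baseChange ℚ_[p]).toAffine.Point, p • Q = 0 → Q = 0)
    (σ : L ≃ₐ[ℚ] L) (hσ : σ • w.1 = w.1) (hσp : ∀ a : 𝓞 L, σ • a - a ^ p ∈ w.1.asIdeal)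
    (P : (W.baseChange (w.1.adicCompletion L)).toAffine.Point) (hP : p • P = 0) : P = 0 := by
  obtain ⟨φ, hφ⟩ := exists_algHom_eq_galAdicCompletionMap (p := p) (L := L) (w := w) σ hσ
  exact forall_prime_nsmul_eq_zero_of_frobeniusLift_anomalous W hp3 hΔ hap hF φ
    (norm_map_sub_pow_lt_one σ hσ φ hφ hσp) P hP

/-! ## §3 The anomalous lattice lemma with row hypotheses only -/

/-- **The lattice lemma `log_ω E(L_w) = E_p(φ)⁻¹𝒪_w` on a good-ANOMALOUS row — row hypotheses only.**
`W/ℚ` globally minimal, `p ≥ 3`, `p ∤ Δ_min(W)`, `a_p ≡ 1 (mod p)`, `E(ℚ_p)[p] = 0`; `w ∣ p` with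
`e(w∣p) = 1`; `φ : K_w →ₐ[ℚ_[p]] K_w` ANY lift of the `p`-power map (`hφp`). Then `y ∈ K_w` is a
`log_ω P`, `P ∈ E(L_w)`, iff `‖φφy − a_p·φy + p·y‖ ≤ ‖p‖` — gen 7's
`exists_padicLog_eq_iff_norm_eulerOperator_le_of_frobeniusLift` with its `hT : E(L_w)[p] = 0` DISCHARGED
by §2. [cite: BlochKato1990, Example 3.11] [cite: SilvermanAEC2009, VII.3.1, IV.6.1, IV.6.4] -/
theorem exists_padicLog_eq_iff_norm_eulerOperator_le_of_frobeniusLift_anomalous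
    [he : Fact (w.1.asIdeal.ramificationIdx (𝓞 ℚ) = 1)]
    (hp3 : 3 ≤ p) (hΔ : ¬ (p : ℤ) ∣ WeierstrassCurve.minimalDiscriminantInt W)
    (hap : (p : ℤ) ∣ W.frobeniusTrace p - 1)
    (hF : ∀ Q : (W.baseChange ℚ_[p]).toAffine.Point, p • Q = 0 → Q = 0)
    (φ : Kw p L w →ₐ[ℚ_[p]] Kw p L w) (hφp : ∀ x : Kw p L w, ‖x‖ ≤ 1 → ‖φ x - x ^ p‖ < 1)
    (y : Kw p L w) :
    haveI := Literature.NumberTheory.EllipticCurves.EulerLattice.isIntegral_baseChange w.1 W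
    (∃ P : (W.baseChange (w.1.adicCompletion L)).toAffine.Point,
      Literature.NumberTheory.EllipticCurves.FormalGroupChart.padicLogPointFiniteExt
        (NormedField.valuation : Valuation (w.1.adicCompletion L) ℝ≥0)
        (W.baseChange (w.1.adicCompletion L)) p P = toCompletion p L w y) ↔
    ‖φ (φ y) - (W.frobeniusTrace p : Kw p L w) * φ y + (p : Kw p L w) * y‖ ≤ ‖(p : Kw p L w)‖ :=
  exists_padicLog_eq_iff_norm_eulerOperator_le_of_frobeniusLift W hΔ φ hφp
    (forall_prime_nsmul_eq_zero_of_frobeniusLift_anomalous W hp3 hΔ hap hF φ hφp) y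

/-- **The anomalous lattice lemma from GLOBAL Frobenius data — row hypotheses only.** acc3's
`KimAtThreeAnomalousTorsion.exists_padicLog_eq_iff_of_frobenius_anomalous` with `hord : ord σ = f(w∣p)`
and `hfix` DISCHARGED and `hF` at `F := ℚ_[p]`: `W/ℚ` globally minimal, `p ≥ 3`, `p ∤ Δ_min(W)`,
`a_p ≡ 1 (mod p)`, `E(ℚ_p)[p] = 0`, `e(w∣p) = 1`, `σ ∈ Aut(L/ℚ)` with `σ • w = w` and `σ • a ≡ a^p (mod 𝔭_w)`,
`φ = σ_w` on `K_w`; then `(∃ P, log_ω P = y) ↔ ‖φφy − a_p·φy + p·y‖ ≤ ‖p‖`.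
[cite: BlochKato1990, Example 3.11] [cite: SilvermanAEC2009, VII.3.1, IV.6.1, IV.6.4] -/
theorem exists_padicLog_eq_iff_of_frobenius_anomalous'
    [he : Fact (w.1.asIdeal.ramificationIdx (𝓞 ℚ) = 1)]
    (hp3 : 3 ≤ p) (hΔ : ¬ (p : ℤ) ∣ WeierstrassCurve.minimalDiscriminantInt W)
    (hap : (p : ℤ) ∣ W.frobeniusTrace p - 1)
    (hF : ∀ Q : (W.baseChange ℚ_[p]).toAffine.Point, p • Q = 0 → Q = 0)
    (σ : L ≃ₐ[ℚ] L) (hσ : σ • w.1 = w.1) (hσp : ∀ a : 𝓞 L, σ • a - a ^ p ∈ w.1.asIdeal)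
    (φ : Kw p L w →ₐ[ℚ_[p]] Kw p L w)
    (hφ : ∀ y, toCompletion p L w (φ y) = galAdicCompletionMap σ hσ (toCompletion p L w y))
    (y : Kw p L w) :
    haveI := Literature.NumberTheory.EllipticCurves.EulerLattice.isIntegral_baseChange w.1 W
    (∃ P : (W.baseChange (w.1.adicCompletion L)).toAffine.Point,
      Literature.NumberTheory.EllipticCurves.FormalGroupChart.padicLogPointFiniteExt
        (NormedField.valuation : Valuation (w.1.adicCompletion L) ℝ≥0)
        (W.baseChange (w.1.adicCompletion L)) p P = toCompletion p L w y) ↔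
    ‖φ (φ y) - (W.frobeniusTrace p : Kw p L w) * φ y + (p : Kw p L w) * y‖ ≤ ‖(p : Kw p L w)‖ :=
  exists_padicLog_eq_iff_norm_eulerOperator_le_of_frobeniusLift_anomalous W hp3 hΔ hap hF φ
    (norm_map_sub_pow_lt_one σ hσ φ hφ hσp) y

/-- **The anomalous lattice lemma, items' spelling**: as
`exists_padicLog_eq_iff_norm_eulerOperator_le_of_frobeniusLift_anomalous` with `E(ℚ_p)[p] = 0` taken as
`Nat.card {Q : (W.baseChange ℚ_[p]).toAffine.Point // p • Q = 0} = 1` (the binder of items 19679 / 19599 /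
20397). [cite: BlochKato1990, Example 3.11] [cite: SilvermanAEC2009, VII.3.1, IV.6.1, IV.6.4] -/
theorem exists_padicLog_eq_iff_norm_eulerOperator_le_of_frobeniusLift_of_natCard_eq_one
    [he : Fact (w.1.asIdeal.ramificationIdx (𝓞 ℚ) = 1)]
    (hp3 : 3 ≤ p) (hΔ : ¬ (p : ℤ) ∣ WeierstrassCurve.minimalDiscriminantInt W)
    (hap : (p : ℤ) ∣ W.frobeniusTrace p - 1)
    (ht : Nat.card {Q : (W.baseChange ℚ_[p]).toAffine.Point // (p : ℕ) • Q = 0} = 1)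
    (φ : Kw p L w →ₐ[ℚ_[p]] Kw p L w) (hφp : ∀ x : Kw p L w, ‖x‖ ≤ 1 → ‖φ x - x ^ p‖ < 1)
    (y : Kw p L w) :
    haveI := Literature.NumberTheory.EllipticCurves.EulerLattice.isIntegral_baseChange w.1 W
    (∃ P : (W.baseChange (w.1.adicCompletion L)).toAffine.Point,
      Literature.NumberTheory.EllipticCurves.FormalGroupChart.padicLogPointFiniteExt
        (NormedField.valuation : Valuation (w.1.adicCompletion L) ℝ≥0)
        (W.baseChange (w.1.adicCompletion L)) p P = toCompletion p L w y) ↔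
    ‖φ (φ y) - (W.frobeniusTrace p : Kw p L w) * φ y + (p : Kw p L w) * y‖ ≤ ‖(p : Kw p L w)‖ :=
  exists_padicLog_eq_iff_norm_eulerOperator_le_of_frobeniusLift_anomalous W hp3 hΔ hap
    (forall_nsmul_eq_zero_of_natCard_eq_one (W.baseChange ℚ_[p]) ht) φ hφp y

/-- **The anomalous lattice lemma from a global Frobenius, items' spelling** (`Nat.card … = 1` for
`E(ℚ_p)[p] = 0`). [cite: BlochKato1990, Example 3.11] [cite: SilvermanAEC2009, VII.3.1, IV.6.1, IV.6.4] -/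
theorem exists_padicLog_eq_iff_of_frobenius_of_natCard_eq_one
    [he : Fact (w.1.asIdeal.ramificationIdx (𝓞 ℚ) = 1)]
    (hp3 : 3 ≤ p) (hΔ : ¬ (p : ℤ) ∣ WeierstrassCurve.minimalDiscriminantInt W)
    (hap : (p : ℤ) ∣ W.frobeniusTrace p - 1)
    (ht : Nat.card {Q : (W.baseChange ℚ_[p]).toAffine.Point // (p : ℕ) • Q = 0} = 1)
    (σ : L ≃ₐ[ℚ] L) (hσ : σ • w.1 = w.1) (hσp : ∀ a : 𝓞 L, σ • a - a ^ p ∈ w.1.asIdeal)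
    (φ : Kw p L w →ₐ[ℚ_[p]] Kw p L w)
    (hφ : ∀ y, toCompletion p L w (φ y) = galAdicCompletionMap σ hσ (toCompletion p L w y))
    (y : Kw p L w) :
    haveI := Literature.NumberTheory.EllipticCurves.EulerLattice.isIntegral_baseChange w.1 W
    (∃ P : (W.baseChange (w.1.adicCompletion L)).toAffine.Point,
      Literature.NumberTheory.EllipticCurves.FormalGroupChart.padicLogPointFiniteExt
        (NormedField.valuation : Valuation (w.1.adicCompletion L) ℝ≥0)
        (W.baseChange (w.1.adicCompletion L)) p P = toCompletion p L w y) ↔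
    ‖φ (φ y) - (W.frobeniusTrace p : Kw p L w) * φ y + (p : Kw p L w) * y‖ ≤ ‖(p : Kw p L w)‖ :=
  exists_padicLog_eq_iff_of_frobenius_anomalous' W hp3 hΔ hap
    (forall_nsmul_eq_zero_of_natCard_eq_one (W.baseChange ℚ_[p]) ht) σ hσ hσp φ hφ y

end Summit.BirchSwinnertonDyer.BirchSwinnertonDyer.Theorems.KPort.Kw

end
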